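import Summits.QuantumFields.BalabanUV.Beta.MultiscaleAveragingPointwise

/-!
# `Summit.QuantumFields.BalabanUV.Beta.MultiscaleLaplacianMember` — engine file 10: the COVARIANT-LAPLACIAN member (3.42)₄'s
# SHAPE for the multi-region averaged MODEL operator `levelOp`, WITHOUT any regularity datum: for `u` supported in cell `k′` with
# `|u| ≤ m` and `x` in cell `k`, `|((D*D)(levelOp)⁻¹u)(x,i)| ≤ (1 + B)·e^{−(κ − (1+d/2)·log L/R)·d_n(t_k,t_{k′})}·m` — because
# `D*D·(levelOp)⁻¹ = 1 − (Σ_j a_jG_jᵀG_j)(levelOp)⁻¹` and the averaging operator maps ℓ²(cell) → ℓ^∞ with the gain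
# `a_max·n^{−2}·√(n^{−d})` (the POINTWISE averaging budget, §1)

HONEST FRAMING (page 1 of everything in this cell).  Discharging `FlowStep.BetaPertH` would make Bałaban's ultraviolet
stability UNCONDITIONAL — a constructive-QFT result; it is NOT the continuum limit and NOT the Clay problem.  This module
discharges nothing of `BetaPertH`; it is [folklore] finite-dimensional bookkeeping, kernel-checked, by the OWNER of binder row D4
(unit `b2b-balaban-beta-an4`, gen 44).  HONEST DEPENDENCY: continuum YM on T⁴ ⇐ BetaPertH ∧ nine spine estimates (0/9 proved);
BetaPertH ⇐ (D1) ∧ (D4) ∧ CAP+tail; G-an2-4 gates asym, D1 and NE2/3/4.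

THE POINT (census precision for [B9] Thm 3.1 at MODEL level).  Of the four sup-norm members of (3.42) «|(G′(U)λ)(x)|,
|(∇_UG′(U)λ)(x)|, |(G′(U)∇*_Uλ)(x)|, |(Δ_UG′(U)λ)(x)| ≦ B₀[(L^jη)², L^jη, L^jη, 1]e^{−δ₀d(y,y′)}|λ|» (p. 397, render read as image),
the FOURTH (prefactor `1`) is reachable for the MODEL operator from the ℓ²-localized engine ALONE: `Δ′_a = Δ_U + Q′*aQ′` (B9
(3.24)), so `Δ_U G′ = 1 − Q′*aQ′G′`, and `(Q′*aQ′f)(x)` for `x` in a cell of side `n` is `a·ω²·n^d`-times a transported CELL MEAN of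
`f`, bounded by `a_maxn^{−2}·√(n^{−d}Σ_{cell}f²)` (`hscale`: `aω²n^d ≤ a_max/n²`) — the `√#cell` of the sup → ℓ² step on the source
is exactly compensated by the `√(n^{−d})` of the mean on the target, up to the graded exchange of the `d`-th powers.  The first
member (3.42)₁ needs the local-regularity datum (file 9b `MultiscaleSupMember`); the gradient members (3.42)₂,₃ and (3.43)–(3.46)₂₋₆
need the covariant-derivative bookkeeping of O.2 item (i) — NOT here.  (Print: Thm 3.12 p. 423 notes that exactly this member
FAILS for the Sect.-D propagators `G, G₁`; for `G′` it is the trivial member.)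

WHAT IS CERTIFIED (kernel, 0 sorry), in the analytic setting of `MultiscaleDecay.hc_levelOp` (as files 7–9); the POINTWISE
AVERAGING BUDGET `|((Σ_l a_lG_lᵀG_l) f)(p)| ≤ a_max·(S_{l_k}²)⁻¹·√((S_{l_k}^d)⁻¹·Σ_{cell k × Cp} f²)` is the sibling file 10a
`MultiscaleAveragingPointwise.abs_levelSum_apply_le`:
* **`real_lap_levelOp_inverse_le_graded`** — THE LAPLACIAN MEMBER'S SHAPE: graded level sides `S_l = L^{e_l}` (`1 ≤ L`, `0 < R`),
  the additive datum on the two cells (NO rate condition — the exponent may be negative; v1.0.1 DOCFIX); for `u` supported in cell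
  `k′` with `|u| ≤ m` and `x` in cell `k`:
  `|((D*D)((levelOp)⁻¹u))(x,i)| ≤ (1 + a_max·√|Cp|·L^A·√((L^A)^d)·e^{4dκ}/μ₀)·e^{−(κ − (1+d/2)·log L/R)·d_n(t_k,t_{k′})}·m`
  (`D*D = covDT ∘ covD`, the covariant lattice Laplacian of `levelOp`): file 8 `real_cellNorm_levelOp_inverse_le_graded` + §1 +
  file 9a `cell_norm_le_of_abs_le`∕`scale_pow_le`; the `u(p)` term lives only on `k = k′` where `d_n(t_k,t_k) = 0`.
  (v1.0.1 DOCFIX, header only, declarations byte-identical to v1 p236040 — cross-read C-ne7bleaf05g14-3: NIT-1 the END needs no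
  rate condition (v1's header listed one); NIT-2 the binder `hR : 0 < R` of `real_lap_levelOp_inverse_le_graded` is IDLE — kept in
  the signature for uniformity with files 9b∕11∕13, where it is used; a consumer may pass any proof of `0 < R`.)
Constants see `d, c, a, C, κ, L, A, R, |Cp|` only; NO local-regularity datum, no side, no level count, no volume.

LOCATORS (shape only, nothing printed asserted; ABSOLUTE RULE): [Balaban1985BackgroundPropagators] (3.16) p. 393, (3.24) p. 394,
Thm 3.1 (3.42)₄ p. 397, Thm 3.12 p. 423; [Balaban1984PropagatorsII] (2.1)–(2.2) p. 224, (2.46) p. 231.  Row D4: NO class change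
(critical-path width 0; D4 DISCHARGE NO DATE); NOT BetaPertH, NOT continuum, NOT Clay, NOT summit progress.
-/

open scoped BigOperators
open Finset

namespace Summit.QuantumFields.BalabanUV.Beta.MultiscaleLaplacianMember

open Summit.QuantumFields.BalabanUV.Beta.MultiscaleCombesThomasL2CellsGraded
  (siteScale_ctrU real_cellNorm_levelOp_inverse_le_graded)
open Summit.QuantumFields.BalabanUV.Beta.MultiscaleSupMemberBall (cell_norm_le_of_abs_le scale_pow_le card_cellCp_le)
open Summit.QuantumFields.BalabanUV.Beta.BoxPoincare (Box)
open Summit.QuantumFields.BalabanUV.Beta.MultiscaleCoerciveTorus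
open Summit.QuantumFields.BalabanUV.Beta.MultiscaleDistance
open Summit.QuantumFields.BalabanUV.Beta.MultiscaleDistanceGraded (scale_le_scale_mul_exp_add)
open Summit.QuantumFields.BalabanUV.Beta.MultiscaleDecayBudget
open Summit.QuantumFields.BalabanUV.Beta.MultiscaleDecay (hc_levelOp decay_levelOp)
open Literature.MathematicalPhysics.QuantumFieldTheory.Balaban1983to89
open Literature.MathematicalPhysics.QuantumFieldTheory.Balaban1983to89.B9Thm37Glue (covD covDT)
open Literature.MathematicalPhysics.QuantumFieldTheory.Balaban1983to89.B9Thm37GluePU (bsrc btgt)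
open Literature.MathematicalPhysics.QuantumFieldTheory.Balaban1983to89.B9Thm37GlueTorusCov (tblk)
open Literature.MathematicalPhysics.QuantumFieldTheory.Balaban1983to89.B9Thm37GlueTorusCovComp (gMean gMeanT gMean_apply gMeanT_apply)
open Literature.MathematicalPhysics.QuantumFieldTheory.Balaban1983to89.B9Thm37GlueTorusCovLevels (levelOp levelSum levelSum_apply)
open B5TorusCover (UT Ctr ctrU)

noncomputable section
open Summit.QuantumFields.BalabanUV.Beta.MultiscaleAveragingPointwise (abs_levelSum_apply_le)

variable {d : ℕ} {N : Fin d → ℕ} [∀ i, NeZero (N i)] [NeZero d] {Cp J K : Type} [Fintype Cp] [DecidableEq Cp] [Nonempty Cp]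
  [Fintype J] [Fintype K] [DecidableEq K] (S : J → ℕ) (hS : ∀ l, 1 ≤ S l) (hdivS : ∀ l i, S l ∣ N i) (lvl : K → J)
  (zc : (k : K) → Ctr N (S (lvl k)))

/-! ## The analytic setting of `MultiscaleDecay.hc_levelOp`, as section variables (as in files 7–9) -/

variable
    (hdisj : ∀ k k' v v', cellPt S hS hdivS lvl zc k v = cellPt S hS hdivS lvl zc k' v' → k = k')
    (hcover : ∀ x : UT N, ∃ k, ∃ v : Box d (S (lvl k)), cellPt S hS hdivS lvl zc k v = x)
    (Rm : UT N × Fin d → Cp → Cp → ℝ) (hRm : ∀ b i j, ∑ k, Rm b k i * Rm b k j = if i = j then (1 : ℝ) else 0)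
    (T : J → UT N → Cp → Cp → ℝ) (hT : ∀ l x i i', ∑ k, T l x k i * T l x k i' = if i = i' then (1 : ℝ) else 0)
    (a : J → ℝ) (ha : ∀ j, 0 ≤ a j) (ω : J → UT N → ℝ)
    (hsupp : ∀ l x, ω l (ctrU N (S l) (tblk (hS l) (hdivS l) x)) ≠ 0 → ∃ k v, lvl k = l ∧ cellPt S hS hdivS lvl zc k v = x)
    {amax : ℝ} (hamax : 0 ≤ amax)
    (hscale : ∀ k, a (lvl k) * ω (lvl k) (ctrU N (S (lvl k)) (zc k)) ^ 2 * (S (lvl k) : ℝ) ^ d ≤ amax / (S (lvl k) : ℝ) ^ 2)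
    (c : UT N × Fin d → ℝ) {cmax : ℝ} (hc : ∀ b, |c b| ≤ cmax) {C : ℝ}
    (hcoer : ∀ f : UT N × Cp → ℝ,
      C * ∑ k, ((S (lvl k) : ℝ) ^ 2)⁻¹ * ∑ v : Box d (S (lvl k)), ∑ i, f (cellPt S hS hdivS lvl zc k v, i) ^ 2 ≤
        ∑ p, f p * levelOp bsrc btgt c Rm (fun l x => ctrU N (S l) (tblk (hS l) (hdivS l) x))
          (fun l x => ω l (ctrU N (S l) (tblk (hS l) (hdivS l) x))) T a f p)
    {κ : ℝ} (hκ0 : 0 ≤ κ) (hκ1 : κ ≤ 1)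

include hdisj hRm hT ha hsupp hamax hscale hc hcoer hκ0 hκ1

/-! ## §2 THE LAPLACIAN MEMBER (3.42)₄'s SHAPE — no regularity datum -/

/-- **THE COVARIANT-LAPLACIAN MEMBER'S SHAPE FOR `levelOp`.**  MODEL setting of `hc_levelOp`; graded level sides `S_l = L^{e_l}`
(`1 ≤ L`, `0 < R`) with the additive datum on the two cells `|e_{l_k} − e_{l_{k′}}| ≤ A + d_n(t_k,t_{k′})/R`; `u` supported in cell `k′`
with `|u| ≤ m`; `p = (x,i)` with `x` in cell `k`.  Then, with `D*D = covDT ∘ covD` the covariant lattice Laplacian of `levelOp`,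
`|((D*D)((levelOp)⁻¹u))(p)| ≤ (1 + a_max·√|Cp|·L^A·√((L^A)^d)·e^{4dκ}/μ₀)·e^{−(κ − (1+d/2)·log L/R)·d_n(t_k,t_{k′})}·m` — print's
«|(Δ_UG′(U)λ)(x)| ≦ B₀·1·e^{−δ₀d(y,y′)}|λ|» SHAPE (prefactor `1`: no power of the local scale), constants seeing
`d, c, a, C, κ, L, A, R, |Cp|` only and NO local-regularity datum.  Proof: `D*D f = levelOp f − (Σ_l a_lG_lᵀG_l)f = u − (…)f`; the
`u`-term lives on `k = k′` only, where `d_n(t_k,t_k) = 0`; the averaging term is §1's pointwise budget on cell `k` times file 8's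
graded cell-to-cell bound times file 9a's sup → ℓ² step on cell `k′`, the volume ratio `√(S_{l_{k′}}^d/S_{l_k}^d)` exchanged by
`scale_pow_le`. [cite: Balaban1985BackgroundPropagators, Thm 3.1 (3.42) p.397 + (3.24) p.394; Balaban1984PropagatorsII, (2.1)-(2.2) p.224] [folklore] -/
theorem real_lap_levelOp_inverse_le_graded
    (hμ : 0 < C - 2 * d * cmax ^ 2 * κ ^ 2 - amax * (Real.exp (2 * d * κ) - 1))
    {L : ℕ} (hL : 1 ≤ L) (e : J → ℕ) (hSe : ∀ l, S l = L ^ e l) {R : ℝ} (hR : 0 < R) {A : ℕ} (k k' : K)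
    (hadd : |(e (lvl k) : ℝ) - e (lvl k')| ≤ A + sdist bsrc btgt (siteScale S hS hdivS lvl zc hcover)
      (ctrU N (S (lvl k)) (zc k)) (ctrU N (S (lvl k')) (zc k')) / R)
    (u : UT N × Cp → ℝ) (hu : ∀ p, cellOf S hS hdivS lvl zc hcover p.1 ≠ k' → u p = 0)
    {m : ℝ} (hm : 0 ≤ m) (hum : ∀ p, |u p| ≤ m) (p : UT N × Cp) (hpk : cellOf S hS hdivS lvl zc hcover p.1 = k) :
    |covDT bsrc btgt c Rm (covD bsrc btgt c Rm
        ((Ring.inverse (levelOp bsrc btgt c Rm (fun l x => ctrU N (S l) (tblk (hS l) (hdivS l) x))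
          (fun l x => ω l (ctrU N (S l) (tblk (hS l) (hdivS l) x))) T a)) u)) p| ≤
      (1 + amax * Real.sqrt (Fintype.card Cp) * (L : ℝ) ^ A * Real.sqrt (((L : ℝ) ^ A) ^ d) * Real.exp (4 * d * κ) /
          (C - 2 * d * cmax ^ 2 * κ ^ 2 - amax * (Real.exp (2 * d * κ) - 1))) *
        Real.exp (-((κ - (1 + d / 2) * (Real.log L / R)) *
          sdist bsrc btgt (siteScale S hS hdivS lvl zc hcover) (ctrU N (S (lvl k)) (zc k)) (ctrU N (S (lvl k')) (zc k')))) * m := by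
  classical
  obtain ⟨i₀⟩ := ‹Nonempty Cp›
  -- §1 and file 8 at our field, BEFORE the abbreviations
  have havg := abs_levelSum_apply_le S hS hdivS lvl zc hdisj hcover T hT a ha ω hsupp hamax hscale
    ((Ring.inverse (levelOp bsrc btgt c Rm (fun l x => ctrU N (S l) (tblk (hS l) (hdivS l) x))
      (fun l x => ω l (ctrU N (S l) (tblk (hS l) (hdivS l) x))) T a)) u) p k hpk
  have hcell := real_cellNorm_levelOp_inverse_le_graded S hS hdivS lvl zc hdisj hcover Rm hRm T hT a ha ω hsupp hamax hscale c hc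
    hcoer hκ0 hκ1 hμ hL e hSe k k' hadd u hu
  set μ₀ := C - 2 * d * cmax ^ 2 * κ ^ 2 - amax * (Real.exp (2 * d * κ) - 1) with hμ₀
  set Aop := levelOp bsrc btgt c Rm (fun l x => ctrU N (S l) (tblk (hS l) (hdivS l) x))
    (fun l x => ω l (ctrU N (S l) (tblk (hS l) (hdivS l) x))) T a with hAop
  set n := siteScale S hS hdivS lvl zc hcover with hn
  set tk : UT N := ctrU N (S (lvl k)) (zc k) with htk
  set tk' : UT N := ctrU N (S (lvl k')) (zc k') with htk'
  set t : ℝ := Real.log L / R with ht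
  set D : ℝ := sdist bsrc btgt n tk tk' with hD
  set f := (Ring.inverse Aop) u with hf
  set Src := univ.filter (fun q : UT N × Cp => cellOf S hS hdivS lvl zc hcover q.1 = k') with hSrc
  set Tgt := univ.filter (fun q : UT N × Cp => cellOf S hS hdivS lvl zc hcover q.1 = k) with hTgt
  set K₁ : ℝ := amax * Real.sqrt (Fintype.card Cp) * (L : ℝ) ^ A * Real.sqrt (((L : ℝ) ^ A) ^ d) * Real.exp (4 * d * κ) / μ₀
    with hK₁
  have hL0 : (0 : ℝ) < L := by exact_mod_cast hL
  have ht0 : 0 ≤ t := div_nonneg (Real.log_nonneg (by exact_mod_cast hL)) hR.le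
  have hSpos : ∀ l, (0 : ℝ) < (S l : ℝ) := fun l => by exact_mod_cast hS l
  have hK₁0 : 0 ≤ K₁ := by positivity
  have hunit : IsUnit Aop :=
    (decay_levelOp S hS hdivS lvl zc hdisj hcover Rm hRm T hT a ha ω hsupp hamax hscale c hc hcoer hκ0 hκ1 hμ
      (tk', i₀) (tk', i₀)).1
  -- `A f = u` and the split `D*D f = u − (Σ a G^T G) f`
  have hAf : Aop f = u := by
    rw [hf, ← Module.End.mul_apply, Ring.mul_inverse_cancel _ hunit, Module.End.one_apply]
  have hsplit : covDT bsrc btgt c Rm (covD bsrc btgt c Rm f) p =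
      u p - levelSum (fun l x => ctrU N (S l) (tblk (hS l) (hdivS l) x))
        (fun l x => ω l (ctrU N (S l) (tblk (hS l) (hdivS l) x))) T a f p := by
    have h := congrArg (fun g : UT N × Cp → ℝ => g p) hAf
    simp only [hAop, levelOp, LinearMap.add_apply, Pi.add_apply, LinearMap.comp_apply] at h
    linarith
  -- the grading of the site scale and the two corners
  have hgr : ∀ y, n y = L ^ (e (lvl (cellOf S hS hdivS lvl zc hcover y))) := fun y => by rw [hn, siteScale, hSe]
  have hk : cellOf S hS hdivS lvl zc hcover tk = k := by
    rw [htk, ← cubePt_zero (hS (lvl k)) (hdivS (lvl k)) (zc k)]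
    exact cellOf_cellPt S hS hdivS lvl zc hdisj hcover k _
  have hk' : cellOf S hS hdivS lvl zc hcover tk' = k' := by
    rw [htk', ← cubePt_zero (hS (lvl k')) (hdivS (lvl k')) (zc k')]
    exact cellOf_cellPt S hS hdivS lvl zc hdisj hcover k' _
  have hntk : (n tk : ℝ) = S (lvl k) := by rw [hn, htk, siteScale_ctrU S hS hdivS lvl zc hdisj hcover k]
  have hntk' : (n tk' : ℝ) = S (lvl k') := by rw [hn, htk', siteScale_ctrU S hS hdivS lvl zc hdisj hcover k']
  -- the volume ratio `√((S_k^d)⁻¹·(S′^d·|Cp|)) ≤ √|Cp|·√((L^A)^d)·e^{(d/2)tD}`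
  have hadd' : |((e (lvl (cellOf S hS hdivS lvl zc hcover tk)) : ℕ) : ℝ) - (e (lvl (cellOf S hS hdivS lvl zc hcover tk')) : ℕ)| ≤
      A + sdist bsrc btgt n tk tk' / R := by rw [hk, hk']; exact hadd
  have hpow : ((S (lvl k') : ℝ)) ^ d ≤ ((L : ℝ) ^ A * Real.exp (t * D) * S (lvl k)) ^ d := by
    have h := scale_pow_le bsrc btgt n hL (fun y => e (lvl (cellOf S hS hdivS lvl zc hcover y))) hgr d (A := A) hadd'
    rw [hntk, hntk'] at h
    simpa only [← ht, ← hD] using h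
  have hSk : (0 : ℝ) < (S (lvl k) : ℝ) ^ d := pow_pos (hSpos _) d
  have hratio : Real.sqrt ((((S (lvl k) : ℝ)) ^ d)⁻¹) * Real.sqrt (((S (lvl k') : ℝ)) ^ d * Fintype.card Cp) ≤
      Real.sqrt (Fintype.card Cp) * Real.sqrt (((L : ℝ) ^ A) ^ d) * Real.exp (d / 2 * (t * D)) := by
    have h1 : (((S (lvl k) : ℝ)) ^ d)⁻¹ * (((S (lvl k') : ℝ)) ^ d * Fintype.card Cp) ≤
        ((L : ℝ) ^ A * Real.exp (t * D)) ^ d * Fintype.card Cp := by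
      rw [inv_mul_le_iff₀ hSk]
      calc ((S (lvl k') : ℝ)) ^ d * (Fintype.card Cp : ℝ)
          ≤ ((L : ℝ) ^ A * Real.exp (t * D) * S (lvl k)) ^ d * Fintype.card Cp :=
            mul_le_mul_of_nonneg_right hpow (Nat.cast_nonneg _)
        _ = (S (lvl k) : ℝ) ^ d * (((L : ℝ) ^ A * Real.exp (t * D)) ^ d * Fintype.card Cp) := by ring
    have hdt : (d : ℝ) * (t * D) / 2 = d / 2 * (t * D) := by ring
    calc Real.sqrt ((((S (lvl k) : ℝ)) ^ d)⁻¹) * Real.sqrt (((S (lvl k') : ℝ)) ^ d * Fintype.card Cp)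
        = Real.sqrt ((((S (lvl k) : ℝ)) ^ d)⁻¹ * (((S (lvl k') : ℝ)) ^ d * Fintype.card Cp)) :=
          (Real.sqrt_mul (inv_nonneg.mpr hSk.le) _).symm
      _ ≤ Real.sqrt (((L : ℝ) ^ A * Real.exp (t * D)) ^ d * Fintype.card Cp) := Real.sqrt_le_sqrt h1
      _ = Real.sqrt (((L : ℝ) ^ A) ^ d) * Real.sqrt (Real.exp (t * D) ^ d) * Real.sqrt (Fintype.card Cp) := by
          rw [Real.sqrt_mul (by positivity), mul_pow, Real.sqrt_mul (pow_nonneg (pow_nonneg hL0.le A) d)]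
      _ = Real.sqrt (Fintype.card Cp) * Real.sqrt (((L : ℝ) ^ A) ^ d) * Real.exp (d / 2 * (t * D)) := by
          have hse : Real.sqrt (Real.exp (d * (t * D))) = Real.exp (d * (t * D) / 2) := by
            rw [show Real.exp (d * (t * D)) = Real.exp (d * (t * D) / 2) ^ 2 by
              rw [← Real.exp_nat_mul]; congr 1; ring]
            exact Real.sqrt_sq (Real.exp_pos _).le
          rw [← Real.exp_nat_mul, hse, hdt]; ring
  -- the averaging term: §1 × file 8 × file 9a
  have hsrc := cell_norm_le_of_abs_le S hS hdivS lvl zc hcover k' u hm hum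
  have hTgt_le : Real.sqrt (∑ q ∈ Tgt, f q ^ 2) ≤
      (L : ℝ) ^ A * Real.exp (4 * d * κ) * ((S (lvl k) : ℝ) ^ 2 / μ₀) * Real.exp (-((κ - t) * D)) *
        (Real.sqrt ((S (lvl k') : ℝ) ^ d * Fintype.card Cp) * m) := by
    have h1 : Real.sqrt (∑ q ∈ Tgt, f q ^ 2) ≤
        (L : ℝ) ^ A * Real.exp (4 * d * κ) * ((S (lvl k) : ℝ) ^ 2 / μ₀) * Real.exp (-((κ - t) * D)) *
          Real.sqrt (∑ q ∈ Src, u q ^ 2) := by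
      simpa only [hTgt, hSrc, hf, hAop, hn, hD, htk, htk', ht] using hcell
    refine h1.trans (mul_le_mul_of_nonneg_left hsrc ?_)
    positivity
  have havg' : |levelSum (fun l x => ctrU N (S l) (tblk (hS l) (hdivS l) x))
      (fun l x => ω l (ctrU N (S l) (tblk (hS l) (hdivS l) x))) T a f p| ≤ K₁ * Real.exp (-((κ - (1 + d / 2) * t) * D)) * m := by
    have h0 : |levelSum (fun l x => ctrU N (S l) (tblk (hS l) (hdivS l) x))
        (fun l x => ω l (ctrU N (S l) (tblk (hS l) (hdivS l) x))) T a f p| ≤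
        amax * ((S (lvl k) : ℝ) ^ 2)⁻¹ * Real.sqrt ((((S (lvl k) : ℝ)) ^ d)⁻¹ * ∑ q ∈ Tgt, f q ^ 2) := by
      simpa only [hTgt, hf, hAop] using havg
    refine h0.trans ?_
    rw [Real.sqrt_mul (inv_nonneg.mpr hSk.le)]
    have hexp2 : Real.exp (-((κ - t) * D)) * Real.exp (d / 2 * (t * D)) = Real.exp (-((κ - (1 + d / 2) * t) * D)) := by
      rw [← Real.exp_add]; congr 1; ring
    have hpre : 0 ≤ amax * ((S (lvl k) : ℝ) ^ 2)⁻¹ * Real.sqrt ((((S (lvl k) : ℝ)) ^ d)⁻¹) := by positivity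
    calc amax * ((S (lvl k) : ℝ) ^ 2)⁻¹ * (Real.sqrt ((((S (lvl k) : ℝ)) ^ d)⁻¹) * Real.sqrt (∑ q ∈ Tgt, f q ^ 2))
        = amax * ((S (lvl k) : ℝ) ^ 2)⁻¹ * Real.sqrt ((((S (lvl k) : ℝ)) ^ d)⁻¹) * Real.sqrt (∑ q ∈ Tgt, f q ^ 2) := by ring
      _ ≤ amax * ((S (lvl k) : ℝ) ^ 2)⁻¹ * Real.sqrt ((((S (lvl k) : ℝ)) ^ d)⁻¹) *
            ((L : ℝ) ^ A * Real.exp (4 * d * κ) * ((S (lvl k) : ℝ) ^ 2 / μ₀) * Real.exp (-((κ - t) * D)) *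
              (Real.sqrt ((S (lvl k') : ℝ) ^ d * Fintype.card Cp) * m)) := mul_le_mul_of_nonneg_left hTgt_le hpre
      _ = (amax * (L : ℝ) ^ A * Real.exp (4 * d * κ) / μ₀ * Real.exp (-((κ - t) * D)) * m) *
            ((((S (lvl k) : ℝ) ^ 2)⁻¹ * (S (lvl k) : ℝ) ^ 2) *
              (Real.sqrt ((((S (lvl k) : ℝ)) ^ d)⁻¹) * Real.sqrt (((S (lvl k') : ℝ)) ^ d * Fintype.card Cp))) := by ring
      _ = (amax * (L : ℝ) ^ A * Real.exp (4 * d * κ) / μ₀ * Real.exp (-((κ - t) * D)) * m) *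
            (Real.sqrt ((((S (lvl k) : ℝ)) ^ d)⁻¹) * Real.sqrt (((S (lvl k') : ℝ)) ^ d * Fintype.card Cp)) := by
          rw [inv_mul_cancel₀ (pow_pos (hSpos (lvl k)) 2).ne', one_mul]
      _ ≤ (amax * (L : ℝ) ^ A * Real.exp (4 * d * κ) / μ₀ * Real.exp (-((κ - t) * D)) * m) *
            (Real.sqrt (Fintype.card Cp) * Real.sqrt (((L : ℝ) ^ A) ^ d) * Real.exp (d / 2 * (t * D))) :=
          mul_le_mul_of_nonneg_left hratio (by positivity)
      _ = K₁ * (Real.exp (-((κ - t) * D)) * Real.exp (d / 2 * (t * D))) * m := by rw [hK₁]; ring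
      _ = K₁ * Real.exp (-((κ - (1 + d / 2) * t) * D)) * m := by rw [hexp2]
  -- the `u`-term and the assembly
  have hE0 : 0 < Real.exp (-((κ - (1 + d / 2) * t) * D)) := Real.exp_pos _
  rw [hsplit]
  by_cases hkk : k = k'
  · -- same cell: `D = 0`
    subst hkk
    have hD0 : D = 0 := by rw [hD, htk, htk']; exact sdist_self bsrc btgt n _
    have hE1 : Real.exp (-((κ - (1 + d / 2) * t) * D)) = 1 := by rw [hD0, mul_zero, neg_zero, Real.exp_zero]
    rw [hE1, mul_one]
    rw [hE1, mul_one] at havg'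
    calc |u p - levelSum (fun l x => ctrU N (S l) (tblk (hS l) (hdivS l) x))
          (fun l x => ω l (ctrU N (S l) (tblk (hS l) (hdivS l) x))) T a f p|
        ≤ |u p| + |levelSum (fun l x => ctrU N (S l) (tblk (hS l) (hdivS l) x))
          (fun l x => ω l (ctrU N (S l) (tblk (hS l) (hdivS l) x))) T a f p| := abs_sub _ _
      _ ≤ m + K₁ * m := add_le_add (hum p) havg'
      _ = (1 + K₁) * m := by ring
  · have hup : u p = 0 := hu p (by rw [hpk]; exact hkk)
    rw [hup, zero_sub, abs_neg]
    refine havg'.trans ?_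
    have : K₁ * Real.exp (-((κ - (1 + d / 2) * t) * D)) * m ≤ (1 + K₁) * Real.exp (-((κ - (1 + d / 2) * t) * D)) * m :=
      mul_le_mul_of_nonneg_right (mul_le_mul_of_nonneg_right (by linarith) hE0.le) hm
    simpa only [hK₁] using this


end

end Summit.QuantumFields.BalabanUV.Beta.MultiscaleLaplacianMember
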